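/-
VALUE = THEOREM (orbit sums of the unified weight over the stabiliser of an ANISOTROPIC vector in
the reflection class group vanish, every odd prime `p`), NOT summit progress (cell b2b-lgcu-borel,
gen 24); the crux item stmt-MatrixMultiplication-14079 is untouched.
-/
import Mathlib
import Literature.NumberTheory.EllipticCurves.BinaryQuarticDiscriminantFpCountProofs
import Summits.MatrixMultiplication.MatrixMultiplication.Theorems.SubgroupIdentityDesigns.Negative.ReflectionClassStabClass
import Summits.MatrixMultiplication.MatrixMultiplication.Theorems.SubgroupIdentityDesigns.Negative.ReflectionClassOrbitS

/-!
# Orbit sums over the stabiliser of an anisotropic vector vanish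

VALUE = THEOREM (generic in the odd prime `p`), NOT summit progress; the crux item
stmt-MatrixMultiplication-14079 is untouched and remains open.

Layer F7a of the all-`p` proof of the unified reflection-class certificate (ORACLE-g24 §G24-1 (S),
§G24-3).  `K = classGroup p σ`, `σ = [c is a square]`, `−c` a non-square, `X₀·X₀ = c`,
`S_x = {s ∈ K : s x = x}` for an ANISOTROPIC `x` (`Q(x) ≠ 0`), `act s v = det(s) · s v`:

  `aniso_orbit_sum :  Σ_{s ∈ S_x} wt c X₀ (act s ω) = 0`  for every `ω`.

* `sum_eq_zero_of_refl` — the INVOLUTION argument: a reflection `R_{z₀} ∈ K` fixing `x` and `ω`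
  (`z₀ ⊥ x, ω` of the class `σ`) makes `s ↦ s R_{z₀}` a fixed-point-free sign-reversing
  involution of the sum (`act R_{z₀} ω = −ω`, `wt(−v) = −wt(v)`); this settles `ω ∥ x`
  (`exists_class`) and `χ(Q(x × ω)) = χ(c)`;
* `sum_refl_mul` — the `(p − 1)`-to-`1` parametrisation of `S_x` by mirror vectors
  (`stab_proper_iff` / `stab_improper_iff` of `ReflectionClassStabClass`);
* the remaining case `χ(Q(x × ω)) = −χ(c)` is `ReflectionClassOrbitS.orbitS_sum` read through that
  parametrisation (`sum_caseB`); `Q(x × ω) = 0` is impossible on the sphere.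
HONEST SCOPE.  One of the two stabiliser types; the isotropic one is `ReflectionClassSiegelClass` +
`ReflectionClassOrbitU`, assembled in the successor layer F7b.
-/

set_option linter.dupNamespace false

open scoped BigOperators Matrix

namespace Summit.MatrixMultiplication.MatrixMultiplication.Theorems.SubgroupIdentityDesigns.Negative
namespace ReflectionClassAnisoOrbit

open Summit.MatrixMultiplication.MatrixMultiplication.Theorems.LieRankDesigns.Negative (GLm Mat)
open ReflectionClassCertificate (V wt act act_mul det3 det3_eq classGroup)
open NonsquareReflections (reflMat refl coe_refl reflMat_mulVec det_reflMat)
open ReflectionClassSphere (wt_neg dot_ne_zero_of_isotropic)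
open ReflectionClassPlane (w₁ w₁_dot_x w₁_dot_ω)
open ReflectionClassIsoLines (exists_frame)
open ReflectionClassIsoSign (iota_of_mem_classGroup)
open ReflectionClassStabClass (refl_mem_classGroup exists_class stab_improper_iff stab_proper_iff
  refl_eq_refl_iff qchar_eq_iff)
open ReflectionClassOrbitS (orbitS_sum)
open Literature.NumberTheory.EllipticCurves.BinaryQuartic (two_ne_zero_zmod)
open DihedralUnipotent (neg_one_ne_one)

variable {p : ℕ} [hp : Fact p.Prime]

/-! ## The twisted action of reflections -/

/-- `act s (−v) = −act s v`. -/
theorem act_neg (s : GLm p 3) (v : V p) : act s (-v) = -act s v := by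
  simp only [act, Matrix.mulVec_neg, smul_neg]

/-- `act R_z v = −R_z v` (`det R_z = −1`). -/
theorem act_refl {z : V p} (hz : z ⬝ᵥ z ≠ 0) (v : V p) :
    act (refl z) v = -(reflMat z *ᵥ v) := by
  rw [act, det3_eq, coe_refl, det_reflMat z hz, neg_one_smul]

/-- `act R_z v = −v` for `v ⊥ z`. -/
theorem act_refl_of_perp {z v : V p} (hz : z ⬝ᵥ z ≠ 0) (hzv : z ⬝ᵥ v = 0) :
    act (refl z) v = -v := by
  rw [act_refl hz, reflMat_mulVec z v hzv]

/-- `act (R_z R_{z₀}) v = R_z (R_{z₀} v)`. -/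
theorem act_refl_mul_refl {z z₀ : V p} (hz : z ⬝ᵥ z ≠ 0) (hz₀ : z₀ ⬝ᵥ z₀ ≠ 0) (v : V p) :
    act (refl z * refl z₀) v = reflMat z *ᵥ (reflMat z₀ *ᵥ v) := by
  rw [act, det3_eq, Units.val_mul, coe_refl, coe_refl, Matrix.det_mul, det_reflMat z hz,
    det_reflMat z₀ hz₀, Matrix.mulVec_mulVec, neg_mul_neg, one_mul, one_smul]

/-- The class is invariant under non-zero scaling. -/
theorem isSquare_smul_iff {t : ZMod p} (ht : t ≠ 0) (z : V p) :
    IsSquare ((t • z) ⬝ᵥ (t • z)) ↔ IsSquare (z ⬝ᵥ z) := by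
  rw [smul_dotProduct, dotProduct_smul, smul_eq_mul, smul_eq_mul]
  constructor
  · rintro ⟨r, hr⟩
    exact ⟨r / t, by field_simp; linear_combination hr⟩
  · rintro ⟨r, hr⟩
    exact ⟨t * r, by rw [hr]; ring⟩

section Invol

variable {σ : Bool} {c : ZMod p} {X₀ x ω : V p}

/-- **Involution argument.**  If a reflection `R_{z₀} ∈ K` fixes `x` and `ω`, the orbit sum over
`S_x` vanishes. -/
theorem sum_eq_zero_of_refl [DecidablePred (· ∈ classGroup p σ)] (hc : ¬ IsSquare (-c))
    (hX : X₀ ⬝ᵥ X₀ = c) {z₀ : V p} (hz₀ : z₀ ⬝ᵥ z₀ ≠ 0)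
    (hz₀σ : decide (IsSquare (z₀ ⬝ᵥ z₀)) = σ) (hz₀x : z₀ ⬝ᵥ x = 0) (hz₀ω : z₀ ⬝ᵥ ω = 0) :
    (∑ s ∈ Finset.univ.filter
        (fun s : GLm p 3 => s ∈ classGroup p σ ∧ (s : Mat p 3) *ᵥ x = x),
      wt c X₀ (act s ω)) = 0 := by
  have hr : refl z₀ ∈ classGroup p σ := refl_mem_classGroup hz₀ hz₀σ
  have hrx : ((refl z₀ : GLm p 3) : Mat p 3) *ᵥ x = x := by
    rw [coe_refl]; exact reflMat_mulVec z₀ x hz₀x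
  have hrω : act (refl z₀) ω = -ω := act_refl_of_perp hz₀ hz₀ω
  rw [Finset.sum_filter]
  have h := Fintype.sum_equiv (Equiv.mulRight (refl z₀))
    (fun s => if s * refl z₀ ∈ classGroup p σ ∧ ((s * refl z₀ : GLm p 3) : Mat p 3) *ᵥ x = x
      then wt c X₀ (act (s * refl z₀) ω) else 0)
    (fun s => if s ∈ classGroup p σ ∧ (s : Mat p 3) *ᵥ x = x then wt c X₀ (act s ω) else 0)
    (fun _ => rfl)
  have key : ∀ s : GLm p 3,
      (if s * refl z₀ ∈ classGroup p σ ∧ ((s * refl z₀ : GLm p 3) : Mat p 3) *ᵥ x = x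
        then wt c X₀ (act (s * refl z₀) ω) else 0) =
      -(if s ∈ classGroup p σ ∧ (s : Mat p 3) *ᵥ x = x then wt c X₀ (act s ω) else 0) := by
    intro s
    have hiff : (s * refl z₀ ∈ classGroup p σ ∧ ((s * refl z₀ : GLm p 3) : Mat p 3) *ᵥ x = x) ↔
        (s ∈ classGroup p σ ∧ (s : Mat p 3) *ᵥ x = x) := by
      rw [Subgroup.mul_mem_cancel_right _ hr, Units.val_mul, ← Matrix.mulVec_mulVec, hrx]
    by_cases hs : s ∈ classGroup p σ ∧ (s : Mat p 3) *ᵥ x = x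
    · rw [if_pos (hiff.mpr hs), if_pos hs, act_mul, hrω, act_neg, wt_neg hc hX]
    · rw [if_neg (mt hiff.mp hs), if_neg hs, neg_zero]
  simp_rw [key, Finset.sum_neg_distrib] at h
  linarith

end Invol

/-! ## Mirror-vector parametrisation of the stabiliser -/

/-- **Fibres of `z ↦ R_z g₀` have `p − 1` elements** on a scaling-closed set of anisotropic
vectors. -/
theorem sum_refl_mul (hp2 : p ≠ 2) (g₀ : GLm p 3) (Z : Finset (V p))
    (hZ : ∀ z ∈ Z, z ⬝ᵥ z ≠ 0) (hZs : ∀ z ∈ Z, ∀ t : ZMod p, t ≠ 0 → t • z ∈ Z)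
    (f : GLm p 3 → ℤ) :
    ∑ z ∈ Z, f (refl z * g₀) =
      ((p : ℤ) - 1) * ∑ s ∈ Z.image (fun z : V p => (refl z : GLm p 3) * g₀), f s := by
  rw [Finset.sum_comp, Finset.mul_sum]
  refine Finset.sum_congr rfl fun b hb => ?_
  obtain ⟨z₁, hz₁, rfl⟩ := Finset.mem_image.mp hb
  have hz₁0 : z₁ ≠ 0 := fun h => hZ z₁ hz₁ (by rw [h, dotProduct_zero])
  have hset : Z.filter (fun a : V p => (refl a : GLm p 3) * g₀ = refl z₁ * g₀) =
      (Finset.univ.filter fun t : ZMod p => t ≠ 0).image (fun t => t • z₁) := by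
    ext a
    simp only [Finset.mem_filter, Finset.mem_image, Finset.mem_univ, true_and]
    constructor
    · rintro ⟨-, h⟩
      obtain ⟨t, ht, rfl⟩ := (refl_eq_refl_iff hp2 (hZ z₁ hz₁)).mp (mul_right_cancel h).symm
      exact ⟨t, ht, rfl⟩
    · rintro ⟨t, ht, rfl⟩
      exact ⟨hZs z₁ hz₁ t ht, by rw [← (refl_eq_refl_iff hp2 (hZ z₁ hz₁)).mpr ⟨t, ht, rfl⟩]⟩
  rw [hset, Finset.card_image_of_injective _ (smul_left_injective (ZMod p) hz₁0),
    Finset.filter_ne' Finset.univ (0 : ZMod p), Finset.card_erase_of_mem (Finset.mem_univ _),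
    Finset.card_univ, ZMod.card, nsmul_eq_mul, Nat.cast_sub hp.out.one_le, Nat.cast_one]

section CaseB

variable {c : ZMod p} {X₀ x ω : V p}

/-- **Case B** (`χ(Q(x × ω)) = −χ(c)`): the orbit sum is `orbitS_sum` read through the
parametrisation `S_x⁻ = {R_z : [z] of class σ}`, `S_x⁺ = {R_z R_{x×ω} : [z] of the other class}`. -/
theorem sum_caseB [DecidablePred (· ∈ classGroup p (decide (IsSquare c)))] (hp2 : p ≠ 2)
    (hc : ¬ IsSquare (-c)) (hX : X₀ ⬝ᵥ X₀ = c) (hω : ω ⬝ᵥ ω = c) (hq : x ⬝ᵥ x ≠ 0)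
    (hQ : w₁ x ω ⬝ᵥ w₁ x ω ≠ 0) (hcl : ¬ (IsSquare (w₁ x ω ⬝ᵥ w₁ x ω) ↔ IsSquare c)) :
    (∑ s ∈ Finset.univ.filter
        (fun s : GLm p 3 => s ∈ classGroup p (decide (IsSquare c)) ∧ (s : Mat p 3) *ᵥ x = x),
      wt c X₀ (act s ω)) = 0 := by
  have hc0 : c ≠ 0 := by rintro rfl; exact hc (by rw [neg_zero]; exact IsSquare.zero)
  have hp1 : ((p : ℤ) - 1) ≠ 0 := by
    have := hp.out.two_le; omega
  -- notation
  obtain ⟨σ, hσ⟩ : ∃ σ : Bool, σ = decide (IsSquare c) := ⟨_, rfl⟩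
  obtain ⟨Q₁, hQ₁⟩ : ∃ Q₁, Q₁ = w₁ x ω ⬝ᵥ w₁ x ω := ⟨_, rfl⟩
  obtain ⟨S, hS⟩ : ∃ S : Finset (GLm p 3), S = Finset.univ.filter
      (fun s : GLm p 3 => s ∈ classGroup p (decide (IsSquare c)) ∧ (s : Mat p 3) *ᵥ x = x) :=
    ⟨_, rfl⟩
  obtain ⟨Zm, hZm⟩ : ∃ Zm : Finset (V p), Zm = Finset.univ.filter (fun z : V p =>
      z ⬝ᵥ x = 0 ∧ (z ⬝ᵥ z ≠ 0 ∧ (IsSquare (z ⬝ᵥ z) ↔ IsSquare c))) := ⟨_, rfl⟩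
  obtain ⟨Zp, hZp⟩ : ∃ Zp : Finset (V p), Zp = Finset.univ.filter (fun z : V p =>
      z ⬝ᵥ x = 0 ∧ (z ⬝ᵥ z ≠ 0 ∧ (IsSquare (z ⬝ᵥ z) ↔ IsSquare (w₁ x ω ⬝ᵥ w₁ x ω)))) :=
    ⟨_, rfl⟩
  rw [← hS]
  -- determinants on `S`
  have hdet : ∀ s ∈ S, (s : Mat p 3).det = 1 ∨ (s : Mat p 3).det = -1 := by
    intro s hs
    rw [hS, Finset.mem_filter] at hs
    obtain ⟨_, h⟩ := iota_of_mem_classGroup hp2 _ hs.2.1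
    rcases h with ⟨h, -⟩ | ⟨h, -⟩
    · exact Or.inl h
    · exact Or.inr h
  -- the two halves of `S`
  have hSp : S.filter (fun s : GLm p 3 => (s : Mat p 3).det = 1) =
      Zp.image (fun z : V p => (refl z : GLm p 3) * refl (w₁ x ω)) := by
    ext s
    rw [Finset.mem_filter, hS, Finset.mem_filter, Finset.mem_image]
    simp only [Finset.mem_univ, true_and]
    rw [and_assoc, stab_proper_iff hp2 hq hQ (w₁_dot_x x ω) hQ s, hZp]
    simp only [Finset.mem_filter, Finset.mem_univ, true_and]
    constructor
    · rintro ⟨z, hzx, hz, hzc, rfl⟩; exact ⟨z, ⟨hzx, hz, hzc⟩, rfl⟩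
    · rintro ⟨z, ⟨hzx, hz, hzc⟩, rfl⟩; exact ⟨z, hzx, hz, hzc, rfl⟩
  have hSm : S.filter (fun s : GLm p 3 => ¬ (s : Mat p 3).det = 1) =
      Zm.image (fun z : V p => (refl z : GLm p 3) * 1) := by
    ext s
    rw [Finset.mem_filter, Finset.mem_image]
    have h1 : (s ∈ S ∧ ¬ (s : Mat p 3).det = 1) ↔ (s ∈ classGroup p σ ∧ (s : Mat p 3) *ᵥ x = x ∧
        (s : Mat p 3).det = -1) := by
      constructor
      · rintro ⟨hs, hd⟩
        have hs' := hs
        rw [hS, Finset.mem_filter] at hs'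
        exact ⟨hσ ▸ hs'.2.1, hs'.2.2, (hdet s hs).resolve_left hd⟩
      · rintro ⟨hs, hsx, hd⟩
        refine ⟨by rw [hS, Finset.mem_filter]; exact ⟨Finset.mem_univ _, hσ ▸ hs, hsx⟩, ?_⟩
        rw [hd]; exact neg_one_ne_one hp2
    rw [h1, stab_improper_iff hp2 hq hQ s, hZm]
    simp only [Finset.mem_filter, Finset.mem_univ, true_and, mul_one]
    constructor
    · rintro ⟨z, hzx, hz, hzc, rfl⟩
      exact ⟨z, ⟨hzx, hz, (decide_eq_decide.mp (hzc.trans hσ))⟩, rfl⟩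
    · rintro ⟨z, ⟨hzx, hz, hzc⟩, rfl⟩
      exact ⟨z, hzx, hz, (decide_eq_decide.mpr hzc).trans hσ.symm, rfl⟩
  -- scaling-closedness of `Zm`, `Zp`
  have hZm_an : ∀ z ∈ Zm, z ⬝ᵥ z ≠ 0 := by
    intro z hz; rw [hZm, Finset.mem_filter] at hz; exact hz.2.2.1
  have hZp_an : ∀ z ∈ Zp, z ⬝ᵥ z ≠ 0 := by
    intro z hz; rw [hZp, Finset.mem_filter] at hz; exact hz.2.2.1
  have hZm_s : ∀ z ∈ Zm, ∀ t : ZMod p, t ≠ 0 → t • z ∈ Zm := by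
    intro z hz t ht
    rw [hZm, Finset.mem_filter] at hz ⊢
    refine ⟨Finset.mem_univ _, by rw [smul_dotProduct, hz.2.1, smul_zero], ?_, ?_⟩
    · rw [smul_dotProduct, dotProduct_smul, smul_eq_mul, smul_eq_mul]
      exact mul_ne_zero ht (mul_ne_zero ht hz.2.2.1)
    · rw [isSquare_smul_iff ht]; exact hz.2.2.2
  have hZp_s : ∀ z ∈ Zp, ∀ t : ZMod p, t ≠ 0 → t • z ∈ Zp := by
    intro z hz t ht
    rw [hZp, Finset.mem_filter] at hz ⊢
    refine ⟨Finset.mem_univ _, by rw [smul_dotProduct, hz.2.1, smul_zero], ?_, ?_⟩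
    · rw [smul_dotProduct, dotProduct_smul, smul_eq_mul, smul_eq_mul]
      exact mul_ne_zero ht (mul_ne_zero ht hz.2.2.1)
    · rw [isSquare_smul_iff ht]; exact hz.2.2.2
  -- the two halves as vector sums
  have eP := sum_refl_mul hp2 (refl (w₁ x ω) : GLm p 3) Zp hZp_an hZp_s
    (fun s => wt c X₀ (act s ω))
  have eM := sum_refl_mul hp2 1 Zm hZm_an hZm_s (fun s => wt c X₀ (act s ω))
  have eP' : ∑ z ∈ Zp, wt c X₀ (act ((refl z : GLm p 3) * refl (w₁ x ω)) ω) =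
      ∑ z ∈ Zp, wt c X₀ (reflMat z *ᵥ ω) := by
    refine Finset.sum_congr rfl fun z hz => ?_
    rw [act_refl_mul_refl (hZp_an z hz) hQ, reflMat_mulVec (w₁ x ω) ω (w₁_dot_ω x ω)]
  have eM' : ∑ z ∈ Zm, wt c X₀ (act ((refl z : GLm p 3) * 1) ω) =
      -∑ z ∈ Zm, wt c X₀ (reflMat z *ᵥ ω) := by
    have h : ∀ z ∈ Zm, wt c X₀ (act ((refl z : GLm p 3) * 1) ω) = -wt c X₀ (reflMat z *ᵥ ω) :=
      fun z hz => by rw [mul_one, act_refl (hZm_an z hz), wt_neg hc hX]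
    rw [Finset.sum_congr rfl h, Finset.sum_neg_distrib]
  -- `orbitS_sum`, split by classes
  have hχc : quadraticChar (ZMod p) c = 1 ∨ quadraticChar (ZMod p) c = -1 :=
    quadraticChar_dichotomy hc0
  have hχ1 : quadraticChar (ZMod p) (w₁ x ω ⬝ᵥ w₁ x ω) = -quadraticChar (ZMod p) c := by
    have hne : quadraticChar (ZMod p) (w₁ x ω ⬝ᵥ w₁ x ω) ≠ quadraticChar (ZMod p) c :=
      fun h => hcl ((qchar_eq_iff hQ hc0).mp h)
    rcases quadraticChar_dichotomy hQ with h1 | h1 <;> rcases hχc with h2 | h2 <;>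
      rw [h1, h2] at hne ⊢ <;> first | exact absurd rfl hne | norm_num
  have hnm : quadraticChar (ZMod p) (c * (w₁ x ω ⬝ᵥ w₁ x ω)) = -1 := by
    rw [map_mul, hχ1]
    rcases hχc with h | h <;> rw [h] <;> norm_num
  have hOS := orbitS_sum hp2 hc hX hω hq hnm
  have hgm : ∑ z ∈ Zm, wt c X₀ (reflMat z *ᵥ ω) = ∑ z ∈ Finset.univ.filter
      (fun z : V p => z ⬝ᵥ x = 0), if (z ⬝ᵥ z ≠ 0 ∧ (IsSquare (z ⬝ᵥ z) ↔ IsSquare c))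
        then wt c X₀ (reflMat z *ᵥ ω) else 0 := by
    rw [hZm, Finset.sum_filter, Finset.sum_filter]; simp_rw [ite_and]
  have hgp : ∑ z ∈ Zp, wt c X₀ (reflMat z *ᵥ ω) = ∑ z ∈ Finset.univ.filter
      (fun z : V p => z ⬝ᵥ x = 0),
        if (z ⬝ᵥ z ≠ 0 ∧ (IsSquare (z ⬝ᵥ z) ↔ IsSquare (w₁ x ω ⬝ᵥ w₁ x ω)))
        then wt c X₀ (reflMat z *ᵥ ω) else 0 := by
    rw [hZp, Finset.sum_filter, Finset.sum_filter]; simp_rw [ite_and]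
  have split : ∑ z ∈ Finset.univ.filter (fun z : V p => z ⬝ᵥ x = 0),
      quadraticChar (ZMod p) (z ⬝ᵥ z) * wt c X₀ (reflMat z *ᵥ ω) =
      quadraticChar (ZMod p) c *
        (∑ z ∈ Zm, wt c X₀ (reflMat z *ᵥ ω) - ∑ z ∈ Zp, wt c X₀ (reflMat z *ᵥ ω)) := by
    rw [hgm, hgp, mul_sub, Finset.mul_sum, Finset.mul_sum, ← Finset.sum_sub_distrib]
    refine Finset.sum_congr rfl fun z _ => ?_
    by_cases hz0 : z ⬝ᵥ z = 0
    · simp [hz0]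
    by_cases h1 : IsSquare (z ⬝ᵥ z) ↔ IsSquare c
    · have h2 : ¬ (z ⬝ᵥ z ≠ 0 ∧ (IsSquare (z ⬝ᵥ z) ↔ IsSquare (w₁ x ω ⬝ᵥ w₁ x ω))) :=
        fun h => hcl (h.2.symm.trans h1)
      rw [if_pos ⟨hz0, h1⟩, if_neg h2, (qchar_eq_iff hz0 hc0).mpr h1, mul_zero, sub_zero]
    · have h2 : IsSquare (z ⬝ᵥ z) ↔ IsSquare (w₁ x ω ⬝ᵥ w₁ x ω) := by tauto
      have hχz : quadraticChar (ZMod p) (z ⬝ᵥ z) = -quadraticChar (ZMod p) c := by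
        have hne : quadraticChar (ZMod p) (z ⬝ᵥ z) ≠ quadraticChar (ZMod p) c :=
          fun h => h1 ((qchar_eq_iff hz0 hc0).mp h)
        rcases quadraticChar_dichotomy hz0 with h3 | h3 <;> rcases hχc with h4 | h4 <;>
          rw [h3, h4] at hne ⊢ <;> first | exact absurd rfl hne | norm_num
      rw [if_neg (fun h => h1 h.2), if_pos ⟨hz0, h2⟩, hχz, mul_zero, zero_sub, neg_mul]
  -- conclusion
  have hdiff : ∑ z ∈ Zp, wt c X₀ (reflMat z *ᵥ ω) - ∑ z ∈ Zm, wt c X₀ (reflMat z *ᵥ ω) = 0 := by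
    rw [split] at hOS
    rcases hχc with h | h <;> rw [h] at hOS <;> linarith
  rw [← Finset.sum_filter_add_sum_filter_not S (fun s : GLm p 3 => (s : Mat p 3).det = 1), hSp,
    hSm]
  apply mul_left_cancel₀ hp1
  rw [mul_add, mul_zero, ← eP, ← eM, eP', eM']
  linarith

end CaseB

/-! ## The orbit sum over the stabiliser of an anisotropic vector -/

section Main

variable {c : ZMod p} {X₀ x : V p}

/-- **MAIN (anisotropic axis).**  `Σ_{s ∈ K, s x = x} wt c X₀ (act s ω) = 0` for `Q(x) ≠ 0`,
`p ≠ 2`, `−c` a non-square, `X₀·X₀ = c`, `K = classGroup p [c is a square]`. -/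
theorem aniso_orbit_sum [DecidablePred (· ∈ classGroup p (decide (IsSquare c)))] (hp2 : p ≠ 2)
    (hc : ¬ IsSquare (-c)) (hX : X₀ ⬝ᵥ X₀ = c) (hq : x ⬝ᵥ x ≠ 0) (ω : V p) :
    (∑ s ∈ Finset.univ.filter
        (fun s : GLm p 3 => s ∈ classGroup p (decide (IsSquare c)) ∧ (s : Mat p 3) *ᵥ x = x),
      wt c X₀ (act s ω)) = 0 := by
  -- off the sphere every term vanishes
  by_cases hω : ω ⬝ᵥ ω = c
  swap
  · refine Finset.sum_eq_zero fun s hs => ReflectionClassCertificate.wt_off ?_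
    rw [Finset.mem_filter] at hs
    obtain ⟨hO, h⟩ := iota_of_mem_classGroup hp2 _ hs.2.1
    have hd : det3 (s : Mat p 3) * det3 (s : Mat p 3) = 1 := by
      rw [det3_eq]; rcases h with ⟨h, -⟩ | ⟨h, -⟩ <;> rw [h] <;> norm_num
    rwa [ReflectionClassCertificate.dot_act (ReflectionClassIsoSign.mem_O3.mp hO) hd]
  by_cases hQ : w₁ x ω ⬝ᵥ w₁ x ω = 0
  · by_cases hw : w₁ x ω = 0
    · -- `ω ∥ x`: every anisotropic `z₀ ⊥ x` of class `σ` is `⊥ ω`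
      obtain ⟨ω', hQ'⟩ := exists_frame hp2 hq
      obtain ⟨z₀, hz₀x, hz₀, hz₀σ⟩ := exists_class hp2 hq hQ' (decide (IsSquare c))
      have hx0 : x ≠ 0 := fun h => hq (by rw [h, dotProduct_zero])
      obtain ⟨a, ha⟩ := ReflectionClassSphere.exists_smul_of_cross_eq_zero hx0
        (show x ⨯₃ ω = 0 from hw)
      refine sum_eq_zero_of_refl hc hX hz₀ hz₀σ hz₀x ?_
      rw [← ha, dotProduct_smul, hz₀x, smul_zero]
    · -- `x × ω ≠ 0` isotropic and `⊥ ω` on the sphere: impossible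
      exact absurd (w₁_dot_ω x ω) (by
        rw [dotProduct_comm]; exact dot_ne_zero_of_isotropic hc hw hQ hω)
  by_cases hcl : IsSquare (w₁ x ω ⬝ᵥ w₁ x ω) ↔ IsSquare c
  · -- case A: `R_{x × ω} ∈ K` fixes `x` and `ω`
    exact sum_eq_zero_of_refl hc hX hQ ((decide_eq_decide).mpr hcl) (w₁_dot_x x ω) (w₁_dot_ω x ω)
  · exact sum_caseB hp2 hc hX hω hq hQ hcl

end Main

end ReflectionClassAnisoOrbit
end Summit.MatrixMultiplication.MatrixMultiplication.Theorems.SubgroupIdentityDesigns.Negative
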